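import Mathlib

/-!
# The integer parabola lift cannot reach `c·p^{3/2}`: Sárközy's theorem as the ceiling of family P2-int
— wall-breaker axis `parabola lifts over finite fields` for the packing stub `stub_tangencySets` of the
crux `LevelOneGL2Designs` (stmt-MatrixMultiplication-14080, route `LevelGradedCohnUmans`), k11 seat 3

The integer lift (Hunter–Pohoata–Verstraëte–Zhang 2026, Prop. 2.3; in tree
`ParabolaLift.srs_of_sqDiffFree`, `…TangencyIntegerLift`) turns `L, N` with `L² + N ≤ p` and a set
`A ⊆ [0, N)` WITHOUT NON-ZERO SQUARE DIFFERENCES into a strong representative system of `AG(2,p)` with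
`L·|A|` flags; with Ruzsa–Lewko digit sets it gives the all-primes records `p^{1.2334}` (and, through
quadratic orders, `p^{5/4}`).  This file records, as a theorem, why the family can never produce the
stub's `c·p^{3/2}`: `L ≤ √p` forces `|A| ≥ c·p ≥ c·N`, a set of POSITIVE DENSITY in `[0,N)` with
`N ≥ c·p → ∞`, and the Furstenberg–Sárközy theorem says such a set contains two elements differing by
a non-zero square.  The Sárközy property is taken as an explicit hypothesis `hSF` (it is a theorem —
Sárközy 1978, Furstenberg 1977; quantitatively `|A| ≤ N/(log N)^{c log log log N}`,
Pintz–Steiger–Szemerédi 1988 — but it is not in Mathlib or in the Literature tree; nothing here is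
conditional on anything unproved in print):

* `mul_le_of_sq_le` — `L² ≤ p` and `c·p^{3/2} ≤ L·|A|` give `c·p ≤ |A|` (divide by `p^{1/2} ≥ L`);
* `intLift_lt_of_sarkozy` — **(registered stub)** under `hSF`, for every `c > 0` there is `p₀` such
  that for all `p ≥ p₀` every admissible datum `(L, N, A)` of the integer lift has `L·|A| < c·p^{3/2}`.

So family P2-int is `o(p^{3/2})`: its reach is the exponent `1/2 + γ` of square-difference-free sets
(`γ ∈ [0.7334, 1)` unknown), never the stub.  The same one-line reduction applies to every FIXED-ORDER
number-field lift (trace-zero slices have density `→ 0` in their box by the multidimensional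
polynomial Szemerédi theorem of Bergelson–Leibman), which is why those lifts stop at `p^{3/2 − 1/d}`;
see AXIS.md of this seat.  Elementary given `hSF`; no definitions, no named facts.
-/

set_option linter.dupNamespace false

open Finset

namespace Summit.MatrixMultiplication.MatrixMultiplication.Theorems.LevelOneGL2Designs.IntLiftCeiling

/-- If `L² ≤ p` and `c · p^{3/2} ≤ L · a` (reals, `0 ≤ a`) then `c · p ≤ a`: divide by `p^{1/2} ≥ L`.
[elementary] -/
theorem mul_le_of_sq_le {p L : ℕ} {a c : ℝ} (hp : 0 < p) (ha : 0 ≤ a) (hL : L ^ 2 ≤ p)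
    (h : c * (p : ℝ) ^ (3 / 2 : ℝ) ≤ L * a) : c * p ≤ a := by
  have hp0 : (0 : ℝ) < p := by exact_mod_cast hp
  have hsqrt : (L : ℝ) ≤ (p : ℝ) ^ (1 / 2 : ℝ) := by
    have hL' : ((L : ℝ)) ^ 2 ≤ (p : ℝ) := by exact_mod_cast hL
    calc (L : ℝ) = ((L : ℝ) ^ 2) ^ (1 / 2 : ℝ) := by
          rw [← Real.sqrt_eq_rpow, Real.sqrt_sq (Nat.cast_nonneg L)]
      _ ≤ (p : ℝ) ^ (1 / 2 : ℝ) := Real.rpow_le_rpow (by positivity) hL' (by norm_num)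
  have hsplit : (p : ℝ) ^ (3 / 2 : ℝ) = p * (p : ℝ) ^ (1 / 2 : ℝ) := by
    rw [show (3 / 2 : ℝ) = 1 + 1 / 2 by norm_num, Real.rpow_add hp0, Real.rpow_one]
  have hhalf : (0 : ℝ) < (p : ℝ) ^ (1 / 2 : ℝ) := Real.rpow_pos_of_pos hp0 _
  rw [hsplit] at h
  -- `c p · p^{1/2} ≤ L a ≤ p^{1/2} a`
  have h2 : (L : ℝ) * a ≤ (p : ℝ) ^ (1 / 2 : ℝ) * a := mul_le_mul_of_nonneg_right hsqrt ha
  have h3 : c * p * (p : ℝ) ^ (1 / 2 : ℝ) ≤ a * (p : ℝ) ^ (1 / 2 : ℝ) := by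
    calc c * p * (p : ℝ) ^ (1 / 2 : ℝ) = c * (p * (p : ℝ) ^ (1 / 2 : ℝ)) := by ring
      _ ≤ L * a := h
      _ ≤ (p : ℝ) ^ (1 / 2 : ℝ) * a := h2
      _ = a * (p : ℝ) ^ (1 / 2 : ℝ) := by ring
  exact le_of_mul_le_mul_right h3 hhalf

/-- **The integer parabola lift is `o(p^{3/2})` (registered stub `intLift_lt_of_sarkozy` of
stmt-MatrixMultiplication-14080).**  Assume the Furstenberg–Sárközy theorem `hSF`: for every `δ > 0`
there is `N₀` such that every `A ⊆ [0, N)`, `N ≥ N₀`, with `|A| ≥ δN` contains `a, a + r²` with `r ≠ 0`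
[cite: Sarkozy1978DifferenceSetsI, Thm 1] (A. Sárközy, Acta Math. Acad. Sci. Hungar. 31 (1978) 125–149;
also H. Furstenberg, J. Anal. Math. 31 (1977) 204–256, Thm 1.2).  Then for every
`c > 0` there is `p₀` such that for all `p ≥ p₀`, all `L, N` with `L² + N ≤ p` and all
`A ⊆ [0, N)` without non-zero square differences — verbatim the hypotheses of the integer lift
`ParabolaLift.srs_of_sqDiffFree` (HPVZ Prop. 2.3), which yields exactly `L·|A|` flags — one has
`L·|A| < c·p^{3/2}`.  Proof: otherwise `L ≤ √p` gives `|A| ≥ c·p ≥ c·N` and `N ≥ |A| ≥ c·p ≥ N₀`.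
[elementary given `hSF`; cite: HunterPohoataVerstraeteZhang2026, §2] -/
theorem intLift_lt_of_sarkozy
    (hSF : ∀ δ : ℝ, 0 < δ → ∃ N₀ : ℕ, ∀ N : ℕ, N₀ ≤ N → ∀ A : Finset ℕ, A ⊆ range N →
      δ * N ≤ A.card → ∃ a ∈ A, ∃ r : ℕ, r ≠ 0 ∧ a + r ^ 2 ∈ A)
    (c : ℝ) (hc : 0 < c) :
    ∃ p₀ : ℕ, ∀ p : ℕ, p₀ ≤ p → ∀ L N : ℕ, L ^ 2 + N ≤ p → ∀ A : Finset ℕ, (∀ a ∈ A, a < N) →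
      (∀ a ∈ A, ∀ b ∈ A, ∀ m : ℕ, a = b + m ^ 2 → a = b) →
      (L : ℝ) * A.card < c * (p : ℝ) ^ (3 / 2 : ℝ) := by
  obtain ⟨N₀, hN₀⟩ := hSF c hc
  -- `p₀` with `c · p₀ ≥ N₀` and `p₀ ≥ 1`
  obtain ⟨p₀, hp₀⟩ := exists_nat_ge ((N₀ : ℝ) / c)
  refine ⟨max p₀ 1, fun p hp L N hLN A hAN hfree => ?_⟩
  have hp1 : 1 ≤ p := le_of_max_le_right hp
  have hpp₀ : p₀ ≤ p := le_of_max_le_left hp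
  by_contra hlt
  rw [not_lt] at hlt
  have hL2 : L ^ 2 ≤ p := le_trans (Nat.le_add_right _ _) hLN
  have hNp : N ≤ p := le_trans (Nat.le_add_left _ _) hLN
  -- `|A| ≥ c p`
  have hA : c * p ≤ A.card := mul_le_of_sq_le (by omega) (Nat.cast_nonneg _) hL2 hlt
  -- `N ≥ |A|`
  have hsub : A ⊆ range N := fun a ha => mem_range.mpr (hAN a ha)
  have hAN' : A.card ≤ N := by simpa using card_le_card hsub
  -- `N ≥ N₀`
  have hcp : (N₀ : ℝ) ≤ c * p := by
    have : (N₀ : ℝ) / c ≤ p := hp₀.trans (by exact_mod_cast hpp₀)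
    rwa [div_le_iff₀ hc, mul_comm] at this
  have hN : N₀ ≤ N := by
    have : (N₀ : ℝ) ≤ N := hcp.trans (hA.trans (by exact_mod_cast hAN'))
    exact_mod_cast this
  -- density: `c · N ≤ |A|` since `N ≤ p`
  have hdens : c * N ≤ A.card := by
    calc c * N ≤ c * p := mul_le_mul_of_nonneg_left (by exact_mod_cast hNp) hc.le
      _ ≤ A.card := hA
  obtain ⟨a, ha, r, hr, har⟩ := hN₀ N hN A hsub hdens
  have := hfree (a + r ^ 2) har a ha r rfl
  exact hr (by simpa using this)

end Summit.MatrixMultiplication.MatrixMultiplication.Theorems.LevelOneGL2Designs.IntLiftCeiling
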